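import Summits.ResolutionOfSingularities.ResolutionOfSingularities.Theorems.ValuativeLuAlphaPTorsorAPFlagTower
import Summits.ResolutionOfSingularities.ResolutionOfSingularities.Theorems.ValuativeLuAlphaPTorsorAPTorsion
import Summits.ResolutionOfSingularities.ResolutionOfSingularities.Theorems.ValuativeLuAlphaPTorsorRankOneAssembly
import Summits.ResolutionOfSingularities.ResolutionOfSingularities.Theorems.ValuativeLuAlphaPTorsorAdaptedHenselRootChart
import HarnessLib

/-!
# The tower on flag-adapted charts: a flag-adapted chart of `K` itself (any rank)

Crux `Valuative.LuAlphaPTorsor` (stmt-ResolutionOfSingularities-0641), line `pfaff-line-log-final-forms`,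
lead seat c4 — F⁸ (assembly) of the rank `≥ 2` Abhyankar core, as the rank-one
`…RankOneAssembly` with FLAG-ADAPTED charts carrying value torsion: `ap_flag_chart_adjoin_finset`
climbs finitely many `α_p`-steps (`ap_flag_towerStep`, `…APFlagTower`, modulo F⁶ᵛ), and
`ap_flag_chart_top` builds a flag-adapted chart of `K` from the landed F³
`stub_adaptedHenselRootChart` (adapted base chart of `K_e`, worker w-F3; its F¹ hypothesis is the
landed `stub_adaptedUnimodular`), S1 `stub_frobeniusTwistSeparable`, the value torsion of the
base chart (`ap_htors_of_isTranscendenceBasis`) and the tower. Anchor (closed form):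
`ap_flag_chart_anchor`. [folklore]
-/

set_option linter.dupNamespace false

open IsLocalRing

namespace Summit.ResolutionOfSingularities.ResolutionOfSingularities.Theorems.PfaffLine

open Literature.AlgebraicGeometry.Resolution

/-- Anchor (closed form): `p^e`-th powers lie in `k(T)` once `k(T)` contains all `p^e`-th powers.
[folklore] -/
theorem ap_flag_chart_anchor : ∀ {k K : Type} [Field k] [Field K] [Algebra k K] (T T' : Set K) (q : ℕ), (∀ z : K, z ^ q ∈ IntermediateField.adjoin k T) → T ⊆ T' → ∀ z : K, z ^ q ∈ IntermediateField.adjoin k T' := by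
  intro k K _ _ _ T T' q h hTT' z
  exact IntermediateField.adjoin.mono k _ _ hTT' (h z)

section Assembly

variable {k K : Type} [Field k] [Field K] [Algebra k K]

variable (hF6v : ∀ p : ℕ, p.Prime → (∀ (Γ₀ : Type) [LinearOrderedCommGroupWithZero Γ₀] (n : ℕ) (τ : Fin n → Γ₀), (∀ i, τ i ≠ 0) → (∀ m : Fin n → ℤ, (∏ i, τ i ^ (m i)) = 1 → m = 0) → ∀ (H : Finset (Fin n → ℤ)), (∀ h ∈ H, (∏ i, τ i ^ (h i)) ≤ 1) → ∃ (C D : Matrix (Fin n) (Fin n) ℤ), C * D = 1 ∧ D * C = 1 ∧ (∀ j, (∏ i, τ i ^ (C j i)) < 1) ∧ (∀ h ∈ H, ∃ e : Fin n → ℕ, ∀ i, h i = ∑ j, (e j : ℤ) * C j i) ∧ ∃ lv : Fin n → ℕ, FlagAdaptedValues (fun j => ∏ i, τ i ^ (C j i)) lv) → ∀ (k K : Type) [Field k] [Field K] [Algebra k K] (O : ValuationSubring K) (n : ℕ) (R : Subalgebra k K) (hRO : R.toSubring ≤ O.toSubring) (x : Fin n → K) (hx : ∀ i, x i ∈ R)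 (lv : Fin n → ℕ), FlagAdaptedChart O R hRO x hx lv → (∀ z : K, z ≠ 0 → ∃ N : ℕ, N ≠ 0 ∧ ∃ m : Fin n → ℤ, O.valuation z ^ N = ∏ i, O.valuation (x i) ^ (m i)) → ∀ (t u : K) (α : Fin n → ℕ), u ∈ R → u⁻¹ ∈ R → O.valuation u = 1 → t ^ p = (∏ i, x i ^ (α i)) * u → (∀ m : Fin n → ℤ, O.valuation t ≠ ∏ i, O.valuation (x i) ^ (m i)) → ∃ (R' : Subalgebra k K) (hR'O : R'.toSubring ≤ O.toSubring) (y : Fin n → K) (hy : ∀ i, y i ∈ R') (lv' : Fin n → ℕ), R ≤ R' ∧ t ∈ R' ∧ ((R' : Set K) ⊆ Subfield.closure ((R : Set K) ∪ {t})) ∧ FlagAdaptedChart O R' hR'O y hy lv' ∧ (∀ i, ∃ (d : Fin n → ℕ) (w : K), w ∈ R' ∧ O.valuation w = 1 ∧ x i = (∏ j, y j ^ (d j)) * w))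

include hF6v

/-- **Flag-adapted charts climb finitely many `α_p`-steps.** [folklore] -/
theorem ap_flag_chart_adjoin_finset {p : ℕ} (hp : p.Prime) [CharP K p] (O : ValuationSubring K)
    (hk : ∀ c : k, algebraMap k K c ∈ O)
    (hA : IsAbhyankarPlace O (algebraMap k K).fieldRange ⊤)
    (s : Finset K) (hs : IntermediateField.adjoin k (s : Set K) = ⊤) (e : ℕ)
    (s₀ : Finset K) (hKe : ∀ z : K, z ^ p ^ e ∈ IntermediateField.adjoin k (s₀ : Set K)) {n : ℕ}
    (hchart : ∃ (R : Subalgebra k K) (hRO : R.toSubring ≤ O.toSubring) (x : Fin n → K) (hx : ∀ i, x i ∈ R) (lv : Fin n → ℕ),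
      R ≤ (IntermediateField.adjoin k (s₀ : Set K)).toSubalgebra ∧
      ((IntermediateField.adjoin k (s₀ : Set K) : Set K) ⊆ Subfield.closure (R : Set K)) ∧
      FlagAdaptedChart O R hRO x hx lv ∧
      (∀ z : K, z ≠ 0 → ∃ N : ℕ, N ≠ 0 ∧ ∃ m : Fin n → ℤ, O.valuation z ^ N = ∏ i, O.valuation (x i) ^ (m i)))
    (T : Finset K) (hT : ∀ z ∈ T, z ^ p ∈ IntermediateField.adjoin k (s₀ : Set K)) :
    ∃ (R : Subalgebra k K) (hRO : R.toSubring ≤ O.toSubring) (x : Fin n → K) (hx : ∀ i, x i ∈ R) (lv : Fin n → ℕ),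
      R ≤ (IntermediateField.adjoin k ((s₀ : Set K) ∪ T)).toSubalgebra ∧
      ((IntermediateField.adjoin k ((s₀ : Set K) ∪ T) : Set K) ⊆ Subfield.closure (R : Set K)) ∧
      FlagAdaptedChart O R hRO x hx lv ∧
      (∀ z : K, z ≠ 0 → ∃ N : ℕ, N ≠ 0 ∧ ∃ m : Fin n → ℤ, O.valuation z ^ N = ∏ i, O.valuation (x i) ^ (m i)) := by
  classical
  induction T using Finset.induction_on with
  | empty =>
    simpa only [Finset.coe_empty, Set.union_empty] using hchart
  | @insert z T hzT ih =>
    have hT' : ∀ z ∈ T, z ^ p ∈ IntermediateField.adjoin k (s₀ : Set K) := fun w hw =>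
      hT w (Finset.mem_insert_of_mem hw)
    obtain ⟨R, hRO, x, hx, lv, hRM, hMR, hflag, htors⟩ := ih hT'
    set M : IntermediateField k K := IntermediateField.adjoin k ((s₀ : Set K) ∪ T) with hMdef
    have hM' : M = IntermediateField.adjoin k ((s₀ ∪ T : Finset K) : Set K) := by
      rw [hMdef, Finset.coe_union]
    have hle : IntermediateField.adjoin k (s₀ : Set K) ≤ M :=
      IntermediateField.adjoin.mono k _ _ Set.subset_union_left
    have hMp : ∀ w : K, w ^ p ^ e ∈ M := fun w => hle (hKe w)
    have hzp : z ^ p ∈ M := hle (hT z (Finset.mem_insert_self z T))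
    obtain ⟨R', hR'O, x', hx', lv', hR'M, hMR', hflag', htors'⟩ :=
      ap_flag_towerStep hF6v hp O hk hA s hs M (s₀ ∪ T) hM' e hMp R hRO x hx lv hRM hMR hflag htors z hzp
    have heq : IntermediateField.adjoin k (insert z (M : Set K)) =
        IntermediateField.adjoin k ((s₀ : Set K) ∪ ↑(insert z T)) := by
      rw [hMdef, IntermediateField.adjoin_insert_adjoin, Finset.coe_insert, Set.union_insert]
    refine ⟨R', hR'O, x', hx', lv', ?_, ?_, hflag', htors'⟩
    · rw [← heq]; exact hR'M
    · rw [← heq]; exact hMR'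

/-- **A flag-adapted chart of `K` itself, with value torsion** (Frobenius twist + adapted base
chart + tower), for a finitely generated `K = k(s)` of characteristic `p` and a zero-dimensional
Abhyankar place `O ⊇ k` of `K/k` of ANY rank; `n = trdeg_k K`. [folklore] -/
theorem ap_flag_chart_top {p : ℕ} (hp : p.Prime) [CharP k p] (O : ValuationSubring K)
    (hk : ∀ c : k, algebraMap k K c ∈ O)
    (hzd : ∀ x : K, x ∈ O → ∃ f : Polynomial k, f ≠ 0 ∧ Polynomial.aeval x f ∈ O.nonunits)
    (hA : IsAbhyankarPlace O (algebraMap k K).fieldRange ⊤)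
    (s : Finset K) (hs : IntermediateField.adjoin k (s : Set K) = ⊤) :
    ∃ (n : ℕ) (R : Subalgebra k K) (hRO : R.toSubring ≤ O.toSubring) (x : Fin n → K)
      (hx : ∀ i, x i ∈ R) (lv : Fin n → ℕ), (∀ z : K, z ∈ Subfield.closure (R : Set K)) ∧
      FlagAdaptedChart O R hRO x hx lv ∧
      (∀ z : K, z ≠ 0 → ∃ N : ℕ, N ≠ 0 ∧ ∃ m : Fin n → ℤ, O.valuation z ^ N = ∏ i, O.valuation (x i) ^ (m i)) ∧
      Algebra.trdeg k K = n := by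
  classical
  haveI : Fact p.Prime := ⟨hp⟩
  haveI : CharP K p := charP_of_injective_algebraMap (algebraMap k K).injective p
  have htopfg : (⊤ : IntermediateField k K).FG := ⟨s, hs⟩
  -- S1: the Frobenius twist
  obtain ⟨e, hsep⟩ := stub_frobeniusTwistSeparable p hp k K O hk htopfg hA
  set Ke : IntermediateField k K := IntermediateField.adjoin k (Set.range fun z : K => z ^ p ^ e)
    with hKe
  set T₀ : Finset K := s.image fun z : K => z ^ p ^ e with hT₀
  have hKeT₀ : Ke = IntermediateField.adjoin k (T₀ : Set K) :=
    adjoin_range_pow_eq_adjoin_finset_image e s hs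
  have hKefg : Ke.FG := ⟨T₀, hKeT₀.symm⟩
  have hKalg : ∀ z : K, IsAlgebraic Ke z := fun z => isAlgebraic_adjoin_range_pow hp.pos e z
  -- F3: the adapted base chart of `K_e`
  obtain ⟨n, R₀, hR₀O, x₀, hx₀, lv₀, hR₀M, hMR₀, hflag₀, hbasis⟩ :=
    stub_adaptedHenselRootChart p hp stub_adaptedUnimodular k K O hk htopfg hzd Ke hKefg
      (isAbhyankarPlace_adjoin_range_pow hp.pos e O hA) hsep hKalg
  have htr : Algebra.trdeg k K = n := by
    have h := hbasis.lift_cardinalMk_eq_trdeg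
    simp only [Cardinal.mk_fintype, Fintype.card_fin, Cardinal.lift_id] at h
    exact h.symm
  have htors₀ : ∀ z : K, z ≠ 0 → ∃ N : ℕ, N ≠ 0 ∧ ∃ m : Fin n → ℤ, O.valuation z ^ N = ∏ i, O.valuation (x₀ i) ^ (m i) :=
    ap_htors_of_isTranscendenceBasis O hk x₀ hflag₀.1.2.1 hflag₀.1.2.2.2.1 hbasis
  -- the tower
  have htower : ∀ d : ℕ, d ≤ e → ∃ (T : Finset K),
      (s.image fun z : K => z ^ p ^ (e - d)) ⊆ T ∧
      (∀ z : K, z ^ p ^ e ∈ IntermediateField.adjoin k (T : Set K)) ∧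
      ∃ (R : Subalgebra k K) (hRO : R.toSubring ≤ O.toSubring) (x : Fin n → K) (hx : ∀ i, x i ∈ R) (lv : Fin n → ℕ), R ≤ (IntermediateField.adjoin k (T : Set K)).toSubalgebra ∧
        ((IntermediateField.adjoin k (T : Set K) : Set K) ⊆ Subfield.closure (R : Set K)) ∧
        FlagAdaptedChart O R hRO x hx lv ∧
        (∀ z : K, z ≠ 0 → ∃ N : ℕ, N ≠ 0 ∧ ∃ m : Fin n → ℤ, O.valuation z ^ N = ∏ i, O.valuation (x i) ^ (m i)) := by
    intro d
    induction d with
    | zero =>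
      intro _
      refine ⟨T₀, by rw [Nat.sub_zero], fun z => ?_, R₀, hR₀O, x₀, hx₀, lv₀, ?_, ?_, hflag₀, htors₀⟩
      · rw [← hKeT₀]; exact pow_mem_adjoin_range_pow p e z
      · rw [← hKeT₀]; exact hR₀M
      · rw [← hKeT₀]; exact hMR₀
    | succ d ih =>
      intro hd
      obtain ⟨T, hsT, hKeT, hchart⟩ := ih (Nat.le_of_succ_le hd)
      set T' : Finset K := s.image fun z : K => z ^ p ^ (e - (d + 1)) with hT'
      have hT'p : ∀ z ∈ T', z ^ p ∈ IntermediateField.adjoin k (T : Set K) := by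
        intro w hw
        obtain ⟨z, hz, rfl⟩ := Finset.mem_image.mp hw
        have hpow : (z ^ p ^ (e - (d + 1))) ^ p = z ^ p ^ (e - d) := by
          rw [← pow_mul, ← pow_succ]
          congr 2
          omega
        rw [hpow]
        exact IntermediateField.subset_adjoin k _ (hsT (Finset.mem_image.mpr ⟨z, hz, rfl⟩))
      obtain ⟨R, hRO, x, hx, lv, hRM, hMR, hflag, htors⟩ :=
        ap_flag_chart_adjoin_finset hF6v hp O hk hA s hs e T hKeT hchart T' hT'p
      refine ⟨T ∪ T', ?_, fun z => ?_, R, hRO, x, hx, lv, ?_, ?_, hflag, htors⟩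
      · exact Finset.subset_union_right
      · exact ap_flag_chart_anchor (T : Set K) ((T ∪ T' : Finset K) : Set K) (p ^ e) hKeT
          (by rw [Finset.coe_union]; exact Set.subset_union_left) z
      · rw [Finset.coe_union]; exact hRM
      · rw [Finset.coe_union]; exact hMR
  obtain ⟨T, hsT, -, R, hRO, x, hx, lv, hRM, hMR, hflag, htors⟩ := htower e le_rfl
  have htop : IntermediateField.adjoin k (T : Set K) = ⊤ := by
    rw [eq_top_iff, ← hs]
    refine IntermediateField.adjoin.mono k _ _ fun z hz => ?_
    have h := hsT (Finset.mem_image.mpr ⟨z, hz, by rw [Nat.sub_self, pow_zero, pow_one]⟩)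
    exact h
  refine ⟨n, R, hRO, x, hx, lv, fun z => hMR ?_, hflag, htors, htr⟩
  rw [htop]
  trivial

end Assembly

end Summit.ResolutionOfSingularities.ResolutionOfSingularities.Theorems.PfaffLine
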